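import Summits.BirchSwinnertonDyer.BirchSwinnertonDyer.Theorems.ThetaPartnerAtTwoSignedTransportAtTwoResidualNaturality
import Summits.BirchSwinnertonDyer.BirchSwinnertonDyer.Theorems.ThetaPartnerAtTwoSignedTransportAtTwoResidualKummer
import Summits.BirchSwinnertonDyer.BirchSwinnertonDyer.Theorems.ThetaPartnerAtTwoSignedTransportAtTwoResidualTransport
import Summits.BirchSwinnertonDyer.Rank1Residual.Iwasawa.InertiaCohomologyPTorsionFinite
import Summits.BirchSwinnertonDyer.Rank1Residual.Iwasawa.UnramifiedConditionFiniteOrbit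
import Literature.NumberTheory.EllipticCurves.Kobayashi2003.SignedSelmer
import Literature.NumberTheory.EllipticCurves.Rank1Residual.Predicates
import HarnessLib

/-!
# Stub `stub_sel2F` of line `bridge` v11 of the crux `SignedTransportAtTwo` (stmt-BirchSwinnertonDyer-20333, route
# `ThetaPartnerAtTwo`) — PROVED: finiteness of the imprimitive quotient at `S₀` of the residual devissage at `2`
# (lead prover bsd-wall-tp2-p1 g4; `--supports stmt-BirchSwinnertonDyer-20333`, registered stub by name + signature)

HONEST FRAMING. THEOREMS ONLY; the file proves one of the five registered stubs of the skeleton of record (v11, sha16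
3df8de797086265a) plus two route-independent lemmas; the crux stays open (stubs `stub_sel2T`, `stub_lam2d`, `stub_V2mtR`);
BSD is not proved by any of this. No import of any route file.

WHAT (GV Invent. Math. 142 (2000) §2 pp. 17, 20–21, read at `2` in residual form).
* `exists_equivariant_torsionBy_equiv_geomTorsion` — the same-points identification `E[p^∞][p] ≃+ E[p]`, equivariant;
* `finite_discreteH1_inertiaIn_torsionBy` — `H¹(I_w(K_∞), E[p^∞][p])` is finite for `w ∤ p` (any number field, curve,
  `ℤ_p`-extension): injections into `H¹(H ⊓ I_v, ·)` and `H¹(I_v, ·)` (tree `Iwasawa.InertiaCohomologyPTorsionFinite`) and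
  `#H¹(I_v, E[p]) < ∞` (Milne ADT I.2.9, tree `finite_discreteH1_inertia_geomTorsion`);
* `stub_sel2F` — inside the residual group `X` cut out by (a) unramified outside `S₀ ∪ {2}`, (b) residually trivial at
  `∞`, (c) signed-Kummer at `2` over `ℚ_∞`, the classes unramified at EVERY odd place form the kernel on `X` of the
  detecting map `Φ = (res_{I_v} ∘ conj_{γⁿ})_{v ∈ S₀, n < 2^N}` (finitely many conjugates represent the places of `ℚ_∞`
  above each odd `v` in the cyclotomic tower: tree `Iwasawa.UnramifiedConditionFiniteOrbit`), with FINITE target; so `X`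
  is finite as soon as that kernel is.

References: [GreenbergVatsal2000] §2 pp. 17, 20–21; [MilneADT2006] I §2 Lemma 2.9; [Washington1997] §13.1.
-/

set_option autoImplicit false
-- D-0017: single-problem summit, so `Summit.BirchSwinnertonDyer.BirchSwinnertonDyer.…` repeats a namespace BY DESIGN.
set_option linter.dupNamespace false

noncomputable section

open scoped Classical AddSubgroup

open WeierstrassCurve NumberField IsDedekindDomain Field Literature Literature.NumberTheory.EllipticCurves
  Literature.NumberTheory.GaloisRepresentations Literature.NumberTheory.EllipticCurves.Kobayashi2003 ZpExtension
  Literature.NumberTheory.EllipticCurves.GreenbergVatsal2000 Literature.NumberTheory.EllipticCurves.GreenbergSelmer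
  Literature.NumberTheory.EllipticCurves.Rank1Residual
  Summit.BirchSwinnertonDyer.Rank1Residual.Iwasawa

namespace Summit.BirchSwinnertonDyer.BirchSwinnertonDyer.Theorems.SignedTransportAtTwo

universe u

/-! ## Finiteness of `H¹(I_w(ℚ_∞), E[p^∞][p])` at a place `w ∤ p` -/

section LocalFinite

variable {K : Type u} [Field K] [NumberField K] (W : WeierstrassCurve K) [W.IsElliptic] (p : ℕ) [Fact p.Prime]
  (κ : ZpExtension K p) (v : HeightOneSpectrum (𝓞 K))

omit [NumberField K] [W.IsElliptic] [Fact p.Prime] in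
/-- The "same points" identification `E[p^∞][p] ≃+ E[p]` is `Γ_K`-equivariant. [folklore] -/
theorem exists_equivariant_torsionBy_equiv_geomTorsion :
    ∃ t : ↥((↥(W.geomPrimaryTorsion p))[(p : ℤ)]) ≃+ geomTorsion W (p : ℤ),
      ∀ (σ : absoluteGaloisGroup K) (x : ↥((↥(W.geomPrimaryTorsion p))[(p : ℤ)])), t (σ • x) = σ • t x := by
  have hmem : ∀ x : ↥((↥(W.geomPrimaryTorsion p))[(p : ℤ)]), ((x : ↥(W.geomPrimaryTorsion p)) : geomPoints W) ∈
      geomTorsion W (p : ℤ) := fun x ↦ by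
    have hx : (p : ℕ) • x = 0 := AddSubgroup.torsionBy.nsmul x
    have hx' : (p : ℕ) • ((x : ↥(W.geomPrimaryTorsion p)) : geomPoints W) = 0 := by
      have h1 := congrArg (fun y : ↥((↥(W.geomPrimaryTorsion p))[(p : ℤ)]) ↦ ((y : ↥(W.geomPrimaryTorsion p)) : geomPoints W)) hx
      simpa only [AddSubgroupClass.coe_nsmul, AddSubmonoidClass.coe_nsmul, ZeroMemClass.coe_zero] using h1
    exact AddSubgroup.torsionBy.nsmul_iff.mpr hx'
  have hmem₁ : ∀ P : geomTorsion W (p : ℤ), (P : geomPoints W) ∈ W.geomPrimaryTorsion p := fun P ↦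
    (AddCommGroup.mem_primaryComponent (p := p)).mpr ⟨1, by rw [pow_one]; exact AddSubgroup.torsionBy.nsmul_iff.mp P.2⟩
  have hmem₂ : ∀ P : geomTorsion W (p : ℤ),
      (⟨(P : geomPoints W), hmem₁ P⟩ : ↥(W.geomPrimaryTorsion p)) ∈ (↥(W.geomPrimaryTorsion p))[(p : ℤ)] := fun P ↦
    AddSubgroup.torsionBy.nsmul_iff.mpr (Subtype.ext (by
      rw [AddSubmonoidClass.coe_nsmul, ZeroMemClass.coe_zero]; exact AddSubgroup.torsionBy.nsmul_iff.mp P.2))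
  refine ⟨{ toFun := fun x ↦ ⟨((x : ↥(W.geomPrimaryTorsion p)) : geomPoints W), hmem x⟩
            invFun := fun P ↦ ⟨⟨(P : geomPoints W), hmem₁ P⟩, hmem₂ P⟩
            left_inv := fun x ↦ Subtype.ext (Subtype.ext rfl)
            right_inv := fun P ↦ Subtype.ext rfl
            map_add' := fun x y ↦ Subtype.ext rfl }, fun σ x ↦ Subtype.ext rfl⟩

/-- **`H¹(inertiaIn H v, E[p^∞][p])` is finite** for `H = ker κ` (any `ℤ_p`-extension) and `v ∤ p`: it injects into
`H¹(H ⊓ I_v, ·)` (`exists_injective_discreteH1_inertiaIn_to_inf`), which injects into `H¹(I_v, ·)` (`I_v ≤ ker κ`,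
`inertia_le_kerSubgroup'`), which is `H¹(I_v, E[p])` along the same-points identification, a FINITE group
(`finite_discreteH1_inertia_geomTorsion`: Milne ADT I.2.9, `#H¹(I_F, B) ≤ #B`). GV §2 p. 17 (the local factor at `η ∤ p`
in residual form). [cite: GreenbergVatsal2000, §2 pp. 17, 20] [cite: MilneADT2006, I §2 Lemma 2.9] -/
theorem finite_discreteH1_inertiaIn_torsionBy (hpv : (p : 𝓞 K) ∉ v.asIdeal) :
    Finite (discreteH1 (inertiaIn κ.kerSubgroup v) ↥((↥(W.geomPrimaryTorsion p))[(p : ℤ)])) := by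
  set M := ↥((↥(W.geomPrimaryTorsion p))[(p : ℤ)]) with hM
  obtain ⟨r₁, hr₁⟩ := exists_injective_discreteH1_inertiaIn_to_inf (K := K) v κ.kerSubgroup M
  have hle : inertia (K := K) v ≤ κ.kerSubgroup ⊓ inertia (K := K) v :=
    le_inf (inertia_le_kerSubgroup' κ v hpv) le_rfl
  let r₂ : Literature.NumberTheory.EllipticCurves.subgroupH1 (κ.kerSubgroup ⊓ inertia (K := K) v) M →+
      Literature.NumberTheory.EllipticCurves.subgroupH1 (inertia (K := K) v) M :=
    Literature.NumberTheory.EllipticCurves.resOfLe M hle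
  have hr₂ : Function.Injective r₂ := by
    refine Function.LeftInverse.injective
      (g := Literature.NumberTheory.EllipticCurves.resOfLe M (inf_le_right : κ.kerSubgroup ⊓ inertia (K := K) v ≤ _))
      fun c ↦ ?_
    have h := congrArg (fun f ↦ f c)
      (Literature.NumberTheory.EllipticCurves.resOfLe_comp_holds (M := M)
        (inf_le_right : κ.kerSubgroup ⊓ inertia (K := K) v ≤ _) hle)
    simp only [AddMonoidHom.coe_comp, Function.comp_apply] at h
    change (Literature.NumberTheory.EllipticCurves.resOfLe M (inf_le_right : κ.kerSubgroup ⊓ inertia (K := K) v ≤ _))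
      (Literature.NumberTheory.EllipticCurves.resOfLe M hle c) = c
    rw [h]
    exact congrArg (fun f ↦ f c) (Literature.NumberTheory.EllipticCurves.resOfLe_refl_holds (M := M) _)
  obtain ⟨t, ht⟩ := exists_equivariant_torsionBy_equiv_geomTorsion W p
  let r₃ := resH1Hom (ContinuousMonoidHom.id (inertia (K := K) v)) t.toAddMonoidHom
    (fun g x ↦ ht (g : absoluteGaloisGroup K) x)
  have hr₃ : Function.Bijective r₃ :=
    resH1Hom_id_bijective_of_addEquiv (G := inertia (K := K) v) t fun g x ↦ ht (g : absoluteGaloisGroup K) x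
  haveI := finite_discreteH1_inertia_geomTorsion W p v hpv
  exact Finite.of_injective (fun c ↦ r₃ (r₂ (r₁ c))) (hr₃.1.comp (hr₂.comp hr₁))

end LocalFinite


/-! ## The registered stub `stub_sel2F` of line `bridge` v11 -/

section Stub

/-- **stub sel2F** (FINITENESS of the imprimitive quotient at `S₀`, CM side; GV §2 pp. 17, 21 read at `2` in residual form).
Inside the residual group `X` cut out by (a) unramified outside `S₀ ∪ {2}`, (b) residually trivial at `∞`, (c) signed-Kummer
at `2`, the subgroup `X♭` of classes unramified at EVERY odd place is the kernel on `X` of the detecting map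
`Φ = (res_{I_v} ∘ conj_{γⁿ})_{v ∈ S₀, n < 2^N}` (finitely many conjugates represent the places of `ℚ_∞` above each odd `v`:
`Γ_ℚ = H · D_v · {γⁿ}`, tree `Iwasawa.exists_forall_eq_mul_decomp_mul_pow` with `κ(D_v) ≠ 1` in the cyclotomic tower,
`forall_conjH1_mem_unramifiedKer_of_forall_lt`), whose target `∏ H¹(I_w(ℚ_∞), A[2^∞][2])` is FINITE
(`finite_discreteH1_inertiaIn_torsionBy`); hence `X ⊆ s(Φ X) + X♭` is finite when `X♭` is. [cite: GreenbergVatsal2000, §2 pp. 17, 21]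
[cite: MilneADT2006, I §2 Lemma 2.9] -/
theorem stub_sel2F :
    ∀ (W : WeierstrassCurve ℚ) [W.IsElliptic] [W.IsGloballyMinimal] (A : WeierstrassCurve ℚ) [A.IsElliptic]
      [A.IsGloballyMinimal], ¬ W.HasCM → W.analyticRank = 0 → GoodSS W 2 → W.frobeniusTrace 2 = 0 →
      A.HasCM → GoodSS A 2 → A.frobeniusTrace 2 = 0 →
    (∃ e : WeierstrassCurve.geomTorsion W (2 : ℤ) ≃+ WeierstrassCurve.geomTorsion A (2 : ℤ),
      ∀ (σ : Field.absoluteGaloisGroup ℚ) (P : WeierstrassCurve.geomTorsion W (2 : ℤ)), e (σ • P) = σ • e P) →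
    ∀ (κ : ZpExtension ℚ 2), κ.IsCyclotomic →
    ∀ (S₀ : Finset (HeightOneSpectrum (𝓞 ℚ))), (∀ v ∈ S₀, ((2 : ℕ) : 𝓞 ℚ) ∉ v.asIdeal) →
      (∀ v : HeightOneSpectrum (𝓞 ℚ), ¬ W.HasGoodReductionAt v → v ∈ S₀) →
      (∀ v : HeightOneSpectrum (𝓞 ℚ), ¬ A.HasGoodReductionAt v → v ∈ S₀) →
    {c : subgroupH1 κ.kerSubgroup ↥((↥(A.geomPrimaryTorsion 2))[(2 : ℤ)]) |
      c ∈ unramifiedOutside κ.kerSubgroup ↥((↥(A.geomPrimaryTorsion 2))[(2 : ℤ)]) 2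
          (∅ : Set (HeightOneSpectrum (𝓞 ℚ))) ∧
        (∀ (w : InfinitePlace ℚ) (σ : Field.absoluteGaloisGroup ℚ),
          Literature.NumberTheory.EllipticCurves.conjH1 κ.kerSubgroup ↥((↥(A.geomPrimaryTorsion 2))[(2 : ℤ)]) σ c ∈
            GreenbergSelmer.infKer κ.kerSubgroup ↥((↥(A.geomPrimaryTorsion 2))[(2 : ℤ)]) w) ∧
        (∀ (v : HeightOneSpectrum (𝓞 ℚ)), ((2 : ℕ) : 𝓞 ℚ) ∈ v.asIdeal → ∀ σ : Field.absoluteGaloisGroup ℚ,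
          A.conjH1 2 κ.kerSubgroup σ
              (pushH1 κ.kerSubgroup ((↥(A.geomPrimaryTorsion 2))[(2 : ℤ)]).subtype (subtype_torsionBy_smul A 2) c) ∈
            localKummerOverOfEmb A 2 κ.kerSubgroup (closureEmb (K := ℚ) (v.adicCompletion ℚ))
              (⨆ n : ℕ, signedLocalPoints κ (v.adicCompletion ℚ) A 1 n))}.Finite →
    {c : subgroupH1 κ.kerSubgroup ↥((↥(A.geomPrimaryTorsion 2))[(2 : ℤ)]) |
      c ∈ unramifiedOutside κ.kerSubgroup ↥((↥(A.geomPrimaryTorsion 2))[(2 : ℤ)]) 2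
          (↑S₀ : Set (HeightOneSpectrum (𝓞 ℚ))) ∧
        (∀ (w : InfinitePlace ℚ) (σ : Field.absoluteGaloisGroup ℚ),
          Literature.NumberTheory.EllipticCurves.conjH1 κ.kerSubgroup ↥((↥(A.geomPrimaryTorsion 2))[(2 : ℤ)]) σ c ∈
            GreenbergSelmer.infKer κ.kerSubgroup ↥((↥(A.geomPrimaryTorsion 2))[(2 : ℤ)]) w) ∧
        (∀ (v : HeightOneSpectrum (𝓞 ℚ)), ((2 : ℕ) : 𝓞 ℚ) ∈ v.asIdeal → ∀ σ : Field.absoluteGaloisGroup ℚ,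
          A.conjH1 2 κ.kerSubgroup σ
              (pushH1 κ.kerSubgroup ((↥(A.geomPrimaryTorsion 2))[(2 : ℤ)]).subtype (subtype_torsionBy_smul A 2) c) ∈
            localKummerOverOfEmb A 2 κ.kerSubgroup (closureEmb (K := ℚ) (v.adicCompletion ℚ))
              (⨆ n : ℕ, signedLocalPoints κ (v.adicCompletion ℚ) A 1 n))}.Finite := by
  intro W _ _ A _ _ hCM hr hssW ha2W hCMA hssA ha2A he κ hκ S₀ hS2 hSW hSA hfin
  obtain ⟨γ, hγ⟩ := κ.surjective (Multiplicative.ofAdd 1)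
  have hγ' : κ.IsTopGenerator γ := hγ
  -- finitely many conjugates represent the places of `ℚ_∞` above each `v ∈ S₀`
  have hrep0 : ∀ v : ↥S₀, ∃ m : ℕ, ∀ σ : Field.absoluteGaloisGroup ℚ, ∃ n < 2 ^ m, ∃ δ ∈ decomp (K := ℚ) v.1,
      ∃ h ∈ κ.kerSubgroup, σ = h * (δ * γ ^ n) := fun v ↦ by
    obtain ⟨δ₀, hδ₀, hne⟩ := exists_mem_decomp_apply_ne_one_of_isCyclotomic hκ (hS2 v.1 v.2)
    exact exists_forall_eq_mul_decomp_mul_pow κ hγ' hδ₀ hne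
  choose N hN using hrep0
  set B : ℕ := 2 ^ (Finset.univ.sup N) with hB
  have hrep : ∀ (v : ↥S₀) (σ : Field.absoluteGaloisGroup ℚ), ∃ n < B, ∃ δ ∈ decomp (K := ℚ) v.1,
      ∃ h ∈ κ.kerSubgroup, σ = h * (δ * γ ^ n) := by
    intro v σ
    obtain ⟨n, hn, δ, hδ, h, hh, e⟩ := hN v σ
    exact ⟨n, hn.trans_le (Nat.pow_le_pow_right Nat.two_pos (Finset.le_sup (Finset.mem_univ v))), δ, hδ, h, hh, e⟩
  -- the detecting map `Φ`
  let Φ : subgroupH1 κ.kerSubgroup ↥((↥(A.geomPrimaryTorsion 2))[(2 : ℤ)]) →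
      ((vn : ↥S₀ × Fin B) → discreteH1 (inertiaIn κ.kerSubgroup vn.1.1) ↥((↥(A.geomPrimaryTorsion 2))[(2 : ℤ)])) :=
    fun c vn ↦ resH1Hom (inertiaInToH κ.kerSubgroup vn.1.1) (AddMonoidHom.id ↥((↥(A.geomPrimaryTorsion 2))[(2 : ℤ)])) (fun _ _ ↦ rfl)
      (Literature.NumberTheory.EllipticCurves.conjH1 κ.kerSubgroup ↥((↥(A.geomPrimaryTorsion 2))[(2 : ℤ)]) (γ ^ (vn.2 : ℕ)) c)
  have hΦsub : ∀ c d, Φ (c - d) = Φ c - Φ d := by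
    intro c d; funext vn; simp only [Φ, map_sub, Pi.sub_apply]
  -- its kernel consists of classes unramified at the places of `S₀`
  have hker : ∀ c, Φ c = 0 → ∀ v ∈ S₀, ∀ σ : Field.absoluteGaloisGroup ℚ,
      Literature.NumberTheory.EllipticCurves.conjH1 κ.kerSubgroup ↥((↥(A.geomPrimaryTorsion 2))[(2 : ℤ)]) σ c ∈
        GreenbergVatsal2000.unramifiedKer κ.kerSubgroup ↥((↥(A.geomPrimaryTorsion 2))[(2 : ℤ)]) v := by
    intro c h0 v hv σ
    refine forall_conjH1_mem_unramifiedKer_of_forall_lt κ ↥((↥(A.geomPrimaryTorsion 2))[(2 : ℤ)]) (hrep ⟨v, hv⟩) (fun n hn ↦ ?_) σ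
    exact congrFun h0 (⟨v, hv⟩, ⟨n, hn⟩)
  -- the target of `Φ` is finite
  haveI : ∀ vn : ↥S₀ × Fin B, Finite (discreteH1 (inertiaIn κ.kerSubgroup vn.1.1) ↥((↥(A.geomPrimaryTorsion 2))[(2 : ℤ)])) := fun vn ↦
    finite_discreteH1_inertiaIn_torsionBy A 2 κ vn.1.1 (hS2 vn.1.1 vn.1.2)
  -- the two sets
  set X : Set (subgroupH1 κ.kerSubgroup ↥((↥(A.geomPrimaryTorsion 2))[(2 : ℤ)])) := {c |
      c ∈ unramifiedOutside κ.kerSubgroup ↥((↥(A.geomPrimaryTorsion 2))[(2 : ℤ)]) 2 (↑S₀ : Set (HeightOneSpectrum (𝓞 ℚ))) ∧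
        (∀ (w : InfinitePlace ℚ) (σ : Field.absoluteGaloisGroup ℚ),
          Literature.NumberTheory.EllipticCurves.conjH1 κ.kerSubgroup ↥((↥(A.geomPrimaryTorsion 2))[(2 : ℤ)]) σ c ∈ GreenbergSelmer.infKer κ.kerSubgroup ↥((↥(A.geomPrimaryTorsion 2))[(2 : ℤ)]) w) ∧
        (∀ (v : HeightOneSpectrum (𝓞 ℚ)), ((2 : ℕ) : 𝓞 ℚ) ∈ v.asIdeal → ∀ σ : Field.absoluteGaloisGroup ℚ,
          A.conjH1 2 κ.kerSubgroup σ
              (pushH1 κ.kerSubgroup ((↥(A.geomPrimaryTorsion 2))[(2 : ℤ)]).subtype (subtype_torsionBy_smul A 2) c) ∈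
            localKummerOverOfEmb A 2 κ.kerSubgroup (closureEmb (K := ℚ) (v.adicCompletion ℚ))
              (⨆ n : ℕ, signedLocalPoints κ (v.adicCompletion ℚ) A 1 n))} with hX
  set Xb : Set (subgroupH1 κ.kerSubgroup ↥((↥(A.geomPrimaryTorsion 2))[(2 : ℤ)])) := {c |
      c ∈ unramifiedOutside κ.kerSubgroup ↥((↥(A.geomPrimaryTorsion 2))[(2 : ℤ)]) 2 (∅ : Set (HeightOneSpectrum (𝓞 ℚ))) ∧
        (∀ (w : InfinitePlace ℚ) (σ : Field.absoluteGaloisGroup ℚ),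
          Literature.NumberTheory.EllipticCurves.conjH1 κ.kerSubgroup ↥((↥(A.geomPrimaryTorsion 2))[(2 : ℤ)]) σ c ∈ GreenbergSelmer.infKer κ.kerSubgroup ↥((↥(A.geomPrimaryTorsion 2))[(2 : ℤ)]) w) ∧
        (∀ (v : HeightOneSpectrum (𝓞 ℚ)), ((2 : ℕ) : 𝓞 ℚ) ∈ v.asIdeal → ∀ σ : Field.absoluteGaloisGroup ℚ,
          A.conjH1 2 κ.kerSubgroup σ
              (pushH1 κ.kerSubgroup ((↥(A.geomPrimaryTorsion 2))[(2 : ℤ)]).subtype (subtype_torsionBy_smul A 2) c) ∈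
            localKummerOverOfEmb A 2 κ.kerSubgroup (closureEmb (K := ℚ) (v.adicCompletion ℚ))
              (⨆ n : ℕ, signedLocalPoints κ (v.adicCompletion ℚ) A 1 n))} with hXb
  change Xb.Finite at hfin
  change X.Finite
  -- `X` is closed under subtraction
  have hXsub : ∀ c ∈ X, ∀ d ∈ X, c - d ∈ X := by
    rintro c ⟨hca, hcb, hcc⟩ d ⟨hda, hdb, hdc⟩
    refine ⟨sub_mem hca hda, fun w σ ↦ ?_, fun v hv σ ↦ ?_⟩
    · rw [map_sub]; exact sub_mem (hcb w σ) (hdb w σ)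
    · rw [map_sub, map_sub]; exact sub_mem (hcc v hv σ) (hdc v hv σ)
  -- classes of `X` with the same `Φ`-value differ by an element of `X♭`
  have hdiff : ∀ c ∈ X, ∀ d ∈ X, Φ c = Φ d → c - d ∈ Xb := by
    intro c hc d hd hΦ
    have h0 : Φ (c - d) = 0 := by rw [hΦsub, hΦ, sub_self]
    obtain ⟨ha, hb, hc'⟩ := hXsub c hc d hd
    refine ⟨?_, hb, hc'⟩
    rw [mem_unramifiedOutside_iff] at ha ⊢
    intro v _ hv2 σ
    by_cases hvS : v ∈ S₀
    · exact hker _ h0 v hvS σ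
    · exact ha v hvS hv2 σ
  -- a section of `Φ` over `Φ(X)` and the covering `X ⊆ s(Φ X) + X♭`
  have himg : (Φ '' X).Finite := Set.toFinite _
  have hsec : ∀ t ∈ Φ '' X, ∃ c, c ∈ X ∧ Φ c = t := fun t ht ↦ ht
  choose! s hs using hsec
  have hsub : X ⊆ Set.image2 (· + ·) (s '' (Φ '' X)) Xb := by
    intro c hc
    have hct : Φ c ∈ Φ '' X := ⟨c, hc, rfl⟩
    refine ⟨s (Φ c), ⟨Φ c, hct, rfl⟩, c - s (Φ c), hdiff c hc _ (hs _ hct).1 (hs _ hct).2.symm, ?_⟩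
    abel
  exact ((himg.image s).image2 _ hfin).subset hsub

end Stub

end Summit.BirchSwinnertonDyer.BirchSwinnertonDyer.Theorems.SignedTransportAtTwo

end
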